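/- Width seat `ym-line-sfw-p2-w5` (prover-ym-line-sfw-p2-w5-g18-0), free hands on planner ym-idea-2 g16's LINE-19 task board (STUB-PLAN-S4b §10,
toward the FREE item T5 = the S4b assembly; crux `AllWindowsColdBox.BoxHighWindowsSU22` = stmt-QuantumFields-24004 / 24335, stub S4b):
third brick — the plaquette circulation of the su(2)-coordinate one-form is the holonomy's vector part up to the T3 error, and is `≤ s` + error. -/
import Summits.QuantumFields.YangMills.Theorems.AllWindowsColdBoxBoxHighLineLandauCirculation
import Summits.QuantumFields.YangMills.Theorems.AllWindowsColdBoxBoxHighLineBootstrapPrelims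
import Summits.QuantumFields.YangMills.Theorems.AllWindowsColdBoxBoxHighLineGaugeBallOfBootstrap

/-!
# LINE-19 S4b §10, third brick of T5: `|λ_p · (imVec ∘ W)_c − imVec(hol_p(W))_c| ≤ 588·M·n_p` and `|imVec(hol_p(W))_c| ≤ s`

For a cold-wall configuration `U`, an interior gauge transform `g`, `W = U^g`:

* `abs_imVec_le_of_cost_le_sq` : a plaquette (or any `P ∈ SU(2)`) of cost `2 − Re tr P ≤ s²` has `|imVec P_c| ≤ s` (✓`imVecSqLeCost`);
* `plaqCostAt_le_of_mem_hodgePlaqs` : on `ColdWall ∧ SmallPlaquettes s`, EVERY plaquette of the Hodge system costs `≤ s²` (those based in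
  `[−1,2H]⁴` by `SmallPlaquettes`; the others lie in a hyperplane `x_k = 2H+1` off the cold box and have all links `1`, cost `0`); by gauge
  invariance (✓`plaqCostAt_gaugeTransformZd`) the same for `W`, `abs_imVec_holonomy_gaugeTransform_le`;
* `re_half_le_gaugeTransform` / `abs_imVec_gaugeTransform_le` : a hemisphere / size bound on the cold-box links of `W` extends to ALL links
  (off the box `W = 1`);
* **`abs_circulation_sub_imVec_holonomy_le`** : `|λ_p · (imVec ∘ W)_c − imVec(plaquetteHolonomyZd W p)_c| ≤ 588·M·Σ_{k<4}Σ_{c'} |imVec(W(edge_k p))_{c'}|`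
  whenever all links of `W` are in the hemisphere `Re ≥ 1/2` with su(2)-coordinates `≤ M` (T3 ✓`quaternionBCH` + brick 2 ✓`landauCoeff_dotProduct_imVec_gaugeTransform`).

Everything proved; no definition; standard axioms.  HONEST LABEL: a helper toward ONE registered stub (S4b) of a critic-PASSed line on the R2ξ″
RECORD-rung crux 24004 / 24335; no stub is proved by name, no crux, rung or summit is proved; the Yang–Mills mass gap is NOT proved by this file.
-/

set_option autoImplicit false

noncomputable section

open Finset Matrix
open Literature.MathematicalPhysics.QuantumFieldTheory hiding boxEdges
open Literature.MathematicalPhysics.QuantumFieldTheory.LatticeMaxwell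
open Literature.MathematicalPhysics.QuantumFieldTheory.AxialGauge
open Summit.QuantumFields.YangMills.Theorems.WeakCouplingRates
open Literature.Probability.LatticeModels (Site mem_halfOpenBox halfOpenBox)
open Literature.MathematicalPhysics.QuantumLattice (LGConfig gaugeTransformZd plaquetteHolonomyZd fundamentalRep)

namespace Summit.QuantumFields.YangMills.Theorems.AllWindowsColdBoxBoxHighLine

/-! ## The holonomy's vector part is at most `s` -/

/-- A group element of cost `2 − Re tr P ≤ s²` (`s ≥ 0`) has su(2)-coordinates `≤ s`. -/
theorem abs_imVec_le_of_cost_le_sq (P : SU2) {s : ℝ} (hs : 0 ≤ s)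
    (h : 2 - ((P : Matrix (Fin 2) (Fin 2) ℂ).trace).re ≤ s ^ 2) (c : Fin 3) : |imVec P c| ≤ s := by
  have h1 : imVec P c ^ 2 ≤ ∑ c' : Fin 3, imVec P c' ^ 2 :=
    Finset.single_le_sum (f := fun c' => imVec P c' ^ 2) (fun _ _ => sq_nonneg _) (Finset.mem_univ c)
  have h2 := (h1.trans (imVecSqLeCost P)).trans h
  exact abs_le_of_sq_le_sq' h2 hs |> fun hh => abs_le.2 hh

/-- The plaquette cost for `SU(2)` is `2 − Re tr` of the holonomy. -/
theorem plaqCostAt_eq_two_sub (U : LGConfig 4 SU2) (x : Site 4) (i j : Fin 4) :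
    plaqCostAt (fundamentalRep (Fin 2)) x i j U =
      2 - (((plaquetteHolonomyZd U x i j : SU2) : Matrix (Fin 2) (Fin 2) ℂ).trace).re := by
  unfold plaqCostAt Literature.MathematicalPhysics.QuantumLattice.plaquetteObs
  rw [Literature.MathematicalPhysics.QuantumLattice.fundamentalRep_apply]
  norm_num

/-- Plaquettes of the Hodge system: ordered directions and base point in `{−1,…,2H+1}⁴` with the far corner inside too. -/
theorem hodgePlaqs_spec {H : ℕ} {p : Plaq 4} (hp : p ∈ hodgePlaqs H) :
    p.2.1 < p.2.2 ∧ (∀ k, -1 ≤ p.1 k ∧ p.1 k ≤ 2 * (H : ℤ) + 1) ∧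
      (p.1 p.2.1 ≤ 2 * (H : ℤ)) ∧ (p.1 p.2.2 ≤ 2 * (H : ℤ)) := by
  classical
  unfold hodgePlaqs at hp
  obtain ⟨q, hq, rfl⟩ := Finset.mem_image.1 hp
  unfold plaquettesIn at hq
  rw [Finset.mem_filter] at hq
  obtain ⟨hq0, hlt, hi, hj, -⟩ := hq
  have hy := mem_halfOpenBox.1 (Finset.mem_product.1 hq0).1
  have hyi := mem_halfOpenBox.1 hi
  have hyj := mem_halfOpenBox.1 hj
  refine ⟨hlt, fun k => ?_, ?_, ?_⟩
  · have := hy k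
    simp only [Plaq.shift_fst, Pi.add_apply, dirCorner]
    push_cast at this ⊢; constructor <;> omega
  · have := hyi q.2.1
    simp only [Plaq.shift_fst, Plaq.shift_snd, Pi.add_apply, dirCorner, Pi.single_eq_same] at this ⊢
    push_cast at this ⊢; omega
  · have := hyj q.2.2
    simp only [Plaq.shift_fst, Plaq.shift_snd, Pi.add_apply, dirCorner, Pi.single_eq_same] at this ⊢
    push_cast at this ⊢; omega

/-- **Every plaquette of the Hodge system costs `≤ s²`** on `ColdWall ∧ SmallPlaquettes s` (`s ≥ 0`). -/
theorem plaqCostAt_le_of_mem_hodgePlaqs {H : ℕ} {U : LGConfig 4 SU2} (hU : ColdWall H U) {s : ℝ}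
    (hS : SmallPlaquettes H s U) {p : Plaq 4} (hp : p ∈ hodgePlaqs H) :
    plaqCostAt (fundamentalRep (Fin 2)) p.1 p.2.1 p.2.2 U ≤ s ^ 2 := by
  obtain ⟨hlt, hb, hbi, hbj⟩ := hodgePlaqs_spec hp
  by_cases hin : ∀ k, p.1 k ≤ 2 * (H : ℤ)
  · exact hS p.1 (fun k => ⟨(hb k).1, hin k⟩) p.2.1 p.2.2 (ne_of_lt hlt)
  · -- some coordinate `k ∉ {i, j}` equals `2H+1`: the plaquette is off the cold box, all its links are `1`
    push Not at hin
    obtain ⟨k, hk⟩ := hin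
    have hki : k ≠ p.2.1 := fun h => by rw [h] at hk; omega
    have hkj : k ≠ p.2.2 := fun h => by rw [h] at hk; omega
    have hout : ∀ (y : Site 4) (μ : Fin 4), 2 * (H : ℤ) < y k → U (y, μ) = 1 := by
      intro y μ hy
      apply hU
      rw [mem_boxEdges_iff]
      push Not
      intro h
      have := (h k).2
      push_cast at this
      omega
    have e1 : U (p.1, p.2.1) = 1 := hout _ _ hk
    have e2 : U (p.1 + Pi.single p.2.1 1, p.2.2) = 1 := hout _ _ (by simp [Pi.add_apply, hki]; omega)
    have e3 : U (p.1 + Pi.single p.2.2 1, p.2.1) = 1 := hout _ _ (by simp [Pi.add_apply, hkj]; omega)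
    have e4 : U (p.1, p.2.2) = 1 := hout _ _ hk
    rw [plaqCostAt_eq_zero_of_links_one p.1 p.2.1 p.2.2 U e1 e2 e3 e4]
    positivity

/-- **The holonomy of `W = U^g` around a Hodge-system plaquette has vector part `≤ s`** on `ColdWall ∧ SmallPlaquettes s`. -/
theorem abs_imVec_holonomy_gaugeTransform_le {H : ℕ} {U : LGConfig 4 SU2} (hU : ColdWall H U) {s : ℝ} (hs : 0 ≤ s)
    (hS : SmallPlaquettes H s U) (g : Site 4 → SU2) {p : Plaq 4} (hp : p ∈ hodgePlaqs H) (c : Fin 3) :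
    |imVec (plaquetteHolonomyZd (gaugeTransformZd g U) p.1 p.2.1 p.2.2) c| ≤ s := by
  refine abs_imVec_le_of_cost_le_sq _ hs ?_ c
  rw [← plaqCostAt_eq_two_sub, plaqCostAt_gaugeTransformZd]
  exact plaqCostAt_le_of_mem_hodgePlaqs hU hS hp

/-! ## From the cold-box links to all links -/

/-- A hemisphere condition on the cold-box links of `W = U^g` holds on all links (off the box `W = 1`). -/
theorem re_half_le_gaugeTransform {H : ℕ} {U : LGConfig 4 SU2} (hU : ColdWall H U) {g : Site 4 → SU2} (hg : IsInteriorGauge H g)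
    (h : ∀ e ∈ boxEdges 4 (2 * H + 1), (1 : ℝ) / 2 ≤ (((gaugeTransformZd g U e : SU2) : Matrix (Fin 2) (Fin 2) ℂ) 0 0).re)
    (E : Literature.MathematicalPhysics.QuantumLattice.ZdEdge 4) :
    (1 : ℝ) / 2 ≤ (((gaugeTransformZd g U E : SU2) : Matrix (Fin 2) (Fin 2) ℂ) 0 0).re := by
  by_cases hE : E ∈ boxEdges 4 (2 * H + 1)
  · exact h E hE
  · rw [gaugeTransformZd_eq_one_of_not_mem_boxEdges hU hg hE]
    show (1 : ℝ) / 2 ≤ ((1 : Matrix (Fin 2) (Fin 2) ℂ) 0 0).re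
    norm_num

/-- A size bound on the su(2)-coordinates of the cold-box links of `W = U^g` holds on all links (off the box they vanish). -/
theorem abs_imVec_gaugeTransform_le {H : ℕ} {U : LGConfig 4 SU2} (hU : ColdWall H U) {g : Site 4 → SU2} (hg : IsInteriorGauge H g)
    {M : ℝ} (hM0 : 0 ≤ M) (h : ∀ e ∈ boxEdges 4 (2 * H + 1), ∀ c : Fin 3, |imVec (gaugeTransformZd g U e) c| ≤ M)
    (E : Literature.MathematicalPhysics.QuantumLattice.ZdEdge 4) (c : Fin 3) : |imVec (gaugeTransformZd g U E) c| ≤ M := by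
  by_cases hE : E ∈ boxEdges 4 (2 * H + 1)
  · exact h E hE c
  · rw [imVec_gaugeTransform_eq_zero_of_not_mem_boxEdges hU hg c hE, abs_zero]; exact hM0

/-! ## T3 applied to a plaquette of `W` -/

/-- **Circulation versus holonomy (T3 on a plaquette).**  Given the quaternion BCH estimate with constant `C₁` (✓`quaternionBCH` gives one),
if all links of `W = U^g` are in the hemisphere with su(2)-coordinates `≤ M`, then for every plaquette label `p = (y,i,j)` and coordinate `c`:
`|λ_p · (imVec ∘ W)_c − imVec(hol_p(W))_c| ≤ C₁·M·Σ_{k<4} Σ_{c'} |imVec(W(edge_k p))_{c'}|`. -/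
theorem abs_circulation_sub_imVec_holonomy_le {H : ℕ} {U : LGConfig 4 SU2} (hU : ColdWall H U) {g : Site 4 → SU2}
    (hg : IsInteriorGauge H g) {C₁ : ℝ}
    (hC₁ : ∀ W : Fin 4 → SU2, (∀ k, (1 : ℝ) / 2 ≤ ((W k : Matrix (Fin 2) (Fin 2) ℂ) 0 0).re) →
      ∀ M : ℝ, (∀ k c, |imVec (W k) c| ≤ M) → ∀ c : Fin 3,
        |imVec (W 0 * W 1 * (W 2)⁻¹ * (W 3)⁻¹) c - (imVec (W 0) c + imVec (W 1) c - imVec (W 2) c - imVec (W 3) c)| ≤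
          C₁ * M * ∑ k : Fin 4, ∑ c' : Fin 3, |imVec (W k) c'|)
    (hre : ∀ E : Literature.MathematicalPhysics.QuantumLattice.ZdEdge 4,
      (1 : ℝ) / 2 ≤ (((gaugeTransformZd g U E : SU2) : Matrix (Fin 2) (Fin 2) ℂ) 0 0).re)
    {M : ℝ} (hM : ∀ (E : Literature.MathematicalPhysics.QuantumLattice.ZdEdge 4) (c : Fin 3), |imVec (gaugeTransformZd g U E) c| ≤ M)
    (p : Plaq 4) (c : Fin 3) :
    |landauCoeff H p ⬝ᵥ (fun e : LandauFree H => imVec (gaugeTransformZd g U e.1.1) c) -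
        imVec (plaquetteHolonomyZd (gaugeTransformZd g U) p.1 p.2.1 p.2.2) c| ≤
      C₁ * M * ∑ k : Fin 4, ∑ c' : Fin 3,
        |imVec ((![gaugeTransformZd g U (p.1, p.2.1), gaugeTransformZd g U (p.1 + Pi.single p.2.1 1, p.2.2),
          gaugeTransformZd g U (p.1 + Pi.single p.2.2 1, p.2.1), gaugeTransformZd g U (p.1, p.2.2)] : Fin 4 → SU2) k) c'| := by
  set Wt : Fin 4 → SU2 := ![gaugeTransformZd g U (p.1, p.2.1), gaugeTransformZd g U (p.1 + Pi.single p.2.1 1, p.2.2),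
    gaugeTransformZd g U (p.1 + Pi.single p.2.2 1, p.2.1), gaugeTransformZd g U (p.1, p.2.2)] with hWt
  have h0 : Wt 0 = gaugeTransformZd g U (p.1, p.2.1) := rfl
  have h1 : Wt 1 = gaugeTransformZd g U (p.1 + Pi.single p.2.1 1, p.2.2) := rfl
  have h2 : Wt 2 = gaugeTransformZd g U (p.1 + Pi.single p.2.2 1, p.2.1) := rfl
  have h3 : Wt 3 = gaugeTransformZd g U (p.1, p.2.2) := rfl
  have hreW : ∀ k, (1 : ℝ) / 2 ≤ ((Wt k : Matrix (Fin 2) (Fin 2) ℂ) 0 0).re := by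
    intro k; fin_cases k
    · exact hre _
    · exact hre _
    · exact hre _
    · exact hre _
  have hMW : ∀ k c, |imVec (Wt k) c| ≤ M := by
    intro k c'; fin_cases k
    · exact hM _ _
    · exact hM _ _
    · exact hM _ _
    · exact hM _ _
  have h := hC₁ Wt hreW M hMW c
  have hhol : Wt 0 * Wt 1 * (Wt 2)⁻¹ * (Wt 3)⁻¹ = plaquetteHolonomyZd (gaugeTransformZd g U) p.1 p.2.1 p.2.2 := by
    rw [h0, h1, h2, h3]; rfl
  have hcirc : imVec (Wt 0) c + imVec (Wt 1) c - imVec (Wt 2) c - imVec (Wt 3) c =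
      landauCoeff H p ⬝ᵥ (fun e : LandauFree H => imVec (gaugeTransformZd g U e.1.1) c) := by
    rw [h0, h1, h2, h3, landauCoeff_dotProduct_imVec_gaugeTransform hU hg p c]
  rw [hhol, hcirc] at h
  rwa [abs_sub_comm] at h

end Summit.QuantumFields.YangMills.Theorems.AllWindowsColdBoxBoxHighLine

end
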